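import Summits.CriticalPhenomena.PercolationContinuityZ3.Theorems.PercNearOneGluingNoHeavyQuantGatedSliceMixLawC2
import Summits.CriticalPhenomena.PercolationContinuityZ3.Theorems.PercNearOneGluingNoHeavyQuantGatedSliceMixLawRegimeBTools
import HarnessLib

/-!
# QUANT lane R8, T-DEC, leg (III), blob case — `LawDec.GatedSliceMixLaw'`, cell A5 (unsaturated mid), SUB-CELL (ii): the mid `k₂` of the
# moved law absorbs the whole shifted low `k₁ + a` and is FILLED UP with part of `k₁`; the rest of `k₁` rides the mids of the weak-mid
# law at the balance point — a genuine mixture, valid when the pair `(k₁, k₂)` is LIGHT or `k₁ ≥ ag(1−z)`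

builds on p205010 (kernel theorem, internal audit signed; external expert review pending)

Support file (`--supports stmt-CriticalPhenomena-4575`), QUANT lane lead seat prim-quant-lead (gen 33), rung R8 of
`run/shared/lean/prim/quant/LADDER.md`.  Memo: typer g30 `…/prim-quant-stmt-g30/MIXLAW-MIXTURES-G30.md` §8 (ii); lead g33 NOTES.
One theorem, standard axioms, no sorries.  The file is the typer's `…QuantGatedSliceMixLawC2` (saturated mid) re-run with the
roles of the two nonzero lows exchanged; tools: `flowAtT_weakMidShare`, `weakMid_capacity_ge` (typer g30), `usage_mul_sub_le` (typer g30),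
`usage_mul_sub_le_light_or` (lead g32).

THE SUB-CELL (plan Π-B2 (ii) of the memo).  Frame of `GatedSliceMixLaw'` in regime A (`h + a ≤ j`, `2h ≥ t`); `k₁` and `ℓ = k₁ + a`
are `t`-lows (`k₁ = 0` allowed), `k₂ ≤ j` a mid compatible with both (`t < k₁ + k₂`), `k₂ + a` a giant; UNSATURATED: `usage(ℓ,k₂)·m₁′ ≤ m₂`; NOT BOTH FIT:
`m₂ < usage(ℓ,k₂)·m₁′ + usage(k₁,k₂)·m₁`; and the pair `(k₁,k₂)` LIGHT (`t − 2k₁ < y(k₂ − k₁)`) OR `t − S ≤ k₁`.  CERTIFICATE: `k₂` takes all of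
`ℓ` and `x = (m₂ − usage(ℓ,k₂)m₁′)/usage(k₁,k₂)` of `k₁` (exactly full); the rest `k₁′ = m₁ − x` is donated to the two mids of `W_h` at the
balance point `θ/(1−θ) = ρ = k₁′/K₁`; the zeros of both laws ride the giant `k₂ + a`.  THE INEQUALITY `y(z + ρw₀) ≤ (1−y)m₂′` follows from
the price bound `w₀/K₁ ≤ (t−k₁)/S` (`weakMid_capacity_ge`), the usage bounds `usage(k₁,k₂)(k₂−S) ≤ t−k₁` (`usage_mul_sub_le_light_or`) and
`usage(ℓ,k₂)(k₂−S) ≤ t−ℓ` (`usage_mul_sub_le`), which give `k₁′(t−k₁) ≤ m₁(t−k₁) + m₁′(t−ℓ) − m₂(k₂−S)` — the same bound as in regime C2 —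
and then top-affordability `y·k₂ ≤ S` exactly as there.  EXACT CENSUS (lead g33, explore/a5mix.py): the certificate holds in 104 531 / 104 531
instances of the sub-cell (and in all 162 317 instances of the complementary heavy-and-small-`k₁` sub-cell, where however the usage bound is
not available and the moved law is DEC by itself — separate files).

* **`LawDec.gatedSliceMixLaw_cellA5_mix`**.

[this work]; plan: typer g30; regime C2 template: typer g30.  The gluing rows served [cite: KozmaNitzan2024, Conjecture 3 (p. 15)]; product
measure [cite: Grimmett1999, §1.3 p. 10].
-/

noncomputable section

namespace Summit.CriticalPhenomena.PercolationContinuityZ3.Theorems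

namespace Quant

open Finset

/-- the two-point law `{lo, hi; g}` (as in `…QuantLawDEC`) -/
local notation3 "TP[" lo ", " hi ", " g ", " h "]" =>
  (g : ℝ) * (if (h : ℕ) = (hi : ℕ) then (1 : ℝ) else 0) + (1 - (g : ℝ)) * (if (h : ℕ) = (lo : ℕ) then (1 : ℝ) else 0)

namespace LawDec

set_option maxHeartbeats 1600000 in
/-- **`GatedSliceMixLaw'` IN CELL A5, SUB-CELL (ii)** (`2(k₁+a) < t`, `k₁+a ≤ j`; `k₂ ≤ j`, `2k₂ ≥ t`, `t < k₁+k₂`; `k₂+a ≥ j+1`;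
`h+a ≤ j`, `2h ≥ t`; unsaturated `usage(k₁+a,k₂)·m₁′ ≤ m₂`; not both fit `m₂ < usage(k₁+a,k₂)·m₁′ + usage(k₁,k₂)·m₁`; the pair `(k₁,k₂)`
light or `t − S ≤ k₁`): the conclusion of `GatedSliceMixLaw'` (`W_h ∉ D` not needed).  See the file header. [this work] -/
theorem gatedSliceMixLaw_cellA5_mix (y z g S lam : ℝ) (a j M h k₁ k₂ : ℕ)
    (hy0 : 0 < y) (hy1 : y < 1) (hz0 : 0 ≤ z) (hz1 : z < 1) (hg1 : g ≤ 1) (hyg : y ≤ (1 - z) * g) (hjM : j < M + a)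
    (hS0 : 0 < S) (hta : y * (M : ℝ) ≤ S) (hhM : h ≤ M) (hSh : S < (h : ℝ))
    (hk : k₁ ≤ k₂) (hk₂M : k₂ ≤ M) (hlam0 : 0 ≤ lam) (hlam1 : lam ≤ 1)
    (hmean : (1 - z) * ((k₁ : ℝ) + ((k₂ : ℝ) - k₁) * lam) = S)
    (hllow : 2 * ((k₁ + a : ℕ) : ℝ) < S + (a : ℝ) * g * (1 - z)) (hlj : k₁ + a ≤ j)
    (hk₂j : k₂ ≤ j) (hk₂mid : S + (a : ℝ) * g * (1 - z) ≤ 2 * (k₂ : ℝ)) (hcomp₁ : S + (a : ℝ) * g * (1 - z) < (k₁ : ℝ) + k₂)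
    (hk₂aG : j + 1 ≤ k₂ + a) (hhaj : h + a ≤ j) (hhmid : S + (a : ℝ) * g * (1 - z) ≤ 2 * (h : ℝ))
    (hunsat : usage y (S + (a : ℝ) * g * (1 - z)) j (k₁ + a) k₂ * ((1 - z) * (1 - lam) * g) ≤ (1 - z) * lam * (1 - g))
    (hfull : (1 - z) * lam * (1 - g) < usage y (S + (a : ℝ) * g * (1 - z)) j (k₁ + a) k₂ * ((1 - z) * (1 - lam) * g)
      + usage y (S + (a : ℝ) * g * (1 - z)) j k₁ k₂ * ((1 - z) * (1 - lam) * (1 - g)))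
    (hcase : S + (a : ℝ) * g * (1 - z) - 2 * (k₁ : ℝ) < y * ((k₂ : ℝ) - k₁) ∨ S + (a : ℝ) * g * (1 - z) - S ≤ (k₁ : ℝ)) :
    ∃ θ : ℝ, 0 ≤ θ ∧ θ < 1 ∧
      DECAtT y (S + (a : ℝ) * g * (1 - z)) j (M + a)
        (fun p => θ * weakMidLaw S g h a p
          + (1 - θ) * (z * (if p = 0 then (1 : ℝ) else 0) + (1 - z) * slice (fun q => TP[k₁, k₂, lam, q]) a g p)) := by
  classical
  set t : ℝ := S + (a : ℝ) * g * (1 - z) with ht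
  -- basic positivity
  have h1z : 0 < 1 - z := by linarith
  have hg0 : 0 < g := by nlinarith
  have h1y : 0 < 1 - y := by linarith
  have ha0 : (0 : ℝ) ≤ a := Nat.cast_nonneg a
  have hh0 : (0 : ℝ) < h := lt_trans hS0 hSh
  have hk₁0 : (0 : ℝ) ≤ k₁ := Nat.cast_nonneg k₁
  have hSh' : 0 < S / (h : ℝ) := div_pos hS0 hh0
  have hw0 : 0 ≤ 1 - S / (h : ℝ) := by rw [sub_nonneg, div_le_one hh0]; exact hSh.le
  have h1lam : 0 ≤ 1 - lam := by linarith
  have hagz : 0 ≤ (a : ℝ) * g * z := mul_nonneg (mul_nonneg ha0 hg0.le) hz0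
  have hk1low : 2 * (k₁ : ℝ) < t := by push_cast at hllow; linarith
  have hyk₂ : y * (k₂ : ℝ) ≤ S := le_trans (mul_le_mul_of_nonneg_left (by exact_mod_cast hk₂M) hy0.le) hta
  have hSt : S ≤ t := by rw [ht]; nlinarith [mul_nonneg ha0 hg0.le]
  have htSl : t - S ≤ ((k₁ + a : ℕ) : ℝ) := by
    push_cast; rw [ht]; nlinarith [mul_nonneg ha0 hg0.le, mul_nonneg (mul_nonneg ha0 hg0.le) hz0]
  have htaha : y * ((h + a : ℕ) : ℝ) ≤ t := by
    have : ((h + a : ℕ) : ℝ) ≤ ((M + a : ℕ) : ℝ) := by exact_mod_cast (by omega : h + a ≤ M + a)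
    push_cast at this ⊢; rw [ht]; nlinarith [mul_nonneg ha0 hg0.le]
  have hcompl : t < ((k₁ + a : ℕ) : ℝ) + k₂ := by push_cast at hcomp₁ ⊢; linarith
  -- masses
  set m₁ : ℝ := (1 - z) * (1 - lam) * (1 - g) with hm₁
  set m₁' : ℝ := (1 - z) * (1 - lam) * g with hm₁'
  set m₂ : ℝ := (1 - z) * lam * (1 - g) with hm₂
  set m₂' : ℝ := (1 - z) * lam * g with hm₂'
  have hm₁0 : 0 ≤ m₁ := mul_nonneg (mul_nonneg h1z.le h1lam) (by linarith)
  have hm₁'0 : 0 ≤ m₁' := mul_nonneg (mul_nonneg h1z.le h1lam) hg0.le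
  have hm₂0 : 0 ≤ m₂ := mul_nonneg (mul_nonneg h1z.le hlam0) (by linarith)
  have hm₂'0 : 0 ≤ m₂' := mul_nonneg (mul_nonneg h1z.le hlam0) hg0.le
  -- λ < 1 (else both lows vanish and `hfull` fails), hence S < k₂
  have hlam1' : lam < 1 := by
    by_contra hc
    have hl1 : lam = 1 := le_antisymm hlam1 (not_lt.1 hc)
    have e1 : m₁ = 0 := by rw [hm₁, hl1]; ring
    have e2 : m₁' = 0 := by rw [hm₁', hl1]; ring
    rw [e1, e2, mul_zero, mul_zero, add_zero] at hfull
    exact absurd hfull (not_lt.2 hm₂0)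
  have hSk₂ : S < (k₂ : ℝ) := by
    have hk' : (k₁ : ℝ) < k₂ := by
      have : k₁ < k₂ := by
        by_contra hc; have : k₂ = k₁ := le_antisymm (not_lt.1 hc) hk
        rw [this] at hcomp₁; linarith
      exact_mod_cast this
    rw [← hmean]
    have h1 : (k₁ : ℝ) + ((k₂ : ℝ) - k₁) * lam < k₂ := by nlinarith
    have h2 : 0 ≤ (k₁ : ℝ) + ((k₂ : ℝ) - k₁) * lam := by nlinarith
    nlinarith
  -- the two usage rates at the mid k₂
  set Ul : ℝ := usage y t j (k₁ + a) k₂ with hUl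
  set U₁ : ℝ := usage y t j k₁ k₂ with hU₁
  have hlk₂ : k₁ + a < k₂ := by
    have : ((k₁ + a : ℕ) : ℝ) < k₂ := by push_cast at hllow hcompl ⊢; linarith
    exact_mod_cast this
  have hk₁k₂ : k₁ < k₂ := by omega
  have hUlpos : 0 < Ul := usage_pos_of_compat y t j (k₁ + a) k₂ hy0 hy1 hllow hlk₂ (Or.inr hcompl)
  have hU₁pos : 0 < U₁ := usage_pos_of_compat y t j k₁ k₂ hy0 hy1 hk1low hk₁k₂ (Or.inr hcomp₁)
  -- the leftover capacity of k₂ after ℓ, filled with x of k₁; the donated rest k₁'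
  set cap : ℝ := m₂ - Ul * m₁' with hcap
  have hcap0 : 0 ≤ cap := by rw [hcap, hUl]; linarith [hunsat]
  set x : ℝ := cap / U₁ with hx
  have hx0 : 0 ≤ x := div_nonneg hcap0 hU₁pos.le
  have hxU : U₁ * x = cap := by rw [hx]; field_simp
  have hxm₁ : x ≤ m₁ := by
    rw [hx, div_le_iff₀ hU₁pos, hcap, hUl]
    have : m₂ < Ul * m₁' + U₁ * m₁ := by rw [hUl, hU₁]; exact hfull
    rw [hUl] at this; linarith
  set k₁' : ℝ := m₁ - x with hk₁'
  have hk₁'0 : 0 ≤ k₁' := by rw [hk₁']; linarith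
  -- capacity of the donor k₁ in W's mids
  obtain ⟨K₁, hK₁⟩ : ∃ K : ℝ, K = (if t < (k₁ : ℝ) + h then S / h * (1 - g) / usage y t j k₁ h else 0)
      + S / h * g / usage y t j k₁ (h + a) := ⟨_, rfl⟩
  have hK₁ge := weakMid_capacity_ge y t S g z j h a k₁ hy0 hy1 hg0.le hg1 hz0 hS0.le hSh ht hk1low hhaj htaha
  rw [← hK₁] at hK₁ge
  have htk₁ : 0 < t - k₁ := by linarith
  have htl : 0 < t - ((k₁ + a : ℕ) : ℝ) := by
    have : (0 : ℝ) ≤ ((k₁ + a : ℕ) : ℝ) := Nat.cast_nonneg _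
    linarith
  have hc0 : 0 < S / h * ((h : ℝ) - S) := mul_pos hSh' (by linarith)
  have hK₁pos : 0 < K₁ := lt_of_lt_of_le (div_pos hc0 htk₁) hK₁ge
  -- the balance point (single donor)
  obtain ⟨ρ, hρ⟩ : ∃ r : ℝ, r = k₁' / K₁ := ⟨_, rfl⟩
  have hρ0 : 0 ≤ ρ := by rw [hρ]; exact div_nonneg hk₁'0 hK₁pos.le
  obtain ⟨θ, hθ⟩ : ∃ q : ℝ, q = ρ / (1 + ρ) := ⟨_, rfl⟩
  have hθ0 : 0 ≤ θ := by rw [hθ]; exact div_nonneg hρ0 (by linarith)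
  have hθ1 : θ < 1 := by rw [hθ, div_lt_one (by linarith)]; linarith
  have h1θ : 0 < 1 - θ := by linarith
  have hθρ : θ = (1 - θ) * ρ := by rw [hθ]; field_simp; ring
  obtain ⟨c₁, hc₁⟩ : ∃ q : ℝ, q = (1 - θ) * k₁' / K₁ := ⟨_, rfl⟩
  have hc₁0 : 0 ≤ c₁ := by rw [hc₁]; exact div_nonneg (mul_nonneg h1θ.le hk₁'0) hK₁pos.le
  have hK₁ne : K₁ ≠ 0 := hK₁pos.ne'
  have hc₁K : c₁ * K₁ = (1 - θ) * k₁' := by rw [hc₁]; field_simp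
  have hcsum : c₁ = θ := by
    calc c₁ = (1 - θ) * (k₁' / K₁) := by rw [hc₁]; ring
      _ = (1 - θ) * ρ := by rw [hρ]
      _ = θ := hθρ.symm
  -- the W-side: one share
  have hhaN : h + a ≤ M + a := by omega
  have hcomp1 : t < (k₁ : ℝ) + ((h + a : ℕ) : ℝ) := by
    push_cast; have : (a : ℝ) * g * (1 - z) ≤ a := by nlinarith [mul_nonneg ha0 hg0.le]
    rw [ht]; linarith
  have hk₁j : k₁ ≤ j := by omega
  have W1 := flowAtT_weakMidShare y t S g c₁ j (M + a) h a k₁ hy0 hy1 hg0.le hg1 hS0.le hc₁0 hk₁j hk1low hhaN hhmid hcomp1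
  rw [← hK₁] at W1
  -- the P-side, part 1: both pairs (ℓ, k₂) and (k₁, k₂), scaled by (1 − θ); k₂ exactly full
  have Pl := flowAtT_pair y t j (M + a) (k₁ + a) k₂ ((1 - θ) * m₁') ((1 - θ) * (Ul * m₁')) hlj hllow (by omega) (Or.inr hk₂mid)
    (Or.inr hcompl) (mul_nonneg h1θ.le hm₁'0) (le_of_eq (by rw [← hUl]; ring))
  have P1 := flowAtT_pair y t j (M + a) k₁ k₂ ((1 - θ) * x) ((1 - θ) * cap) hk₁j hk1low (by omega) (Or.inr hk₂mid)
    (Or.inr hcomp₁) (mul_nonneg h1θ.le hx0) (le_of_eq (by rw [← hxU, ← hU₁]; ring))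
  -- THE inequality: the zeros fit the giant k₂ + a
  have hineq : y / (1 - y) * (z + ρ * (1 - S / h)) ≤ m₂' := by
    have hb1 : k₁' / K₁ ≤ k₁' * (t - k₁) / (S / h * ((h : ℝ) - S)) := by
      rw [div_le_div_iff₀ hK₁pos hc0]
      have h1 : S / h * ((h : ℝ) - S) ≤ K₁ * (t - k₁) := (div_le_iff₀ htk₁).1 hK₁ge
      calc k₁' * (S / h * ((h : ℝ) - S)) ≤ k₁' * (K₁ * (t - k₁)) := mul_le_mul_of_nonneg_left h1 hk₁'0
        _ = k₁' * (t - k₁) * K₁ := by ring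
    have hρle : ρ * (1 - S / h) ≤ k₁' * (t - k₁) / S := by
      have hsum : ρ ≤ k₁' * (t - k₁) / (S / h * ((h : ℝ) - S)) := by rw [hρ]; exact hb1
      have hne1 : (h : ℝ) ≠ 0 := hh0.ne'
      have hne2 : (h : ℝ) - S ≠ 0 := by intro h0; linarith
      have hne3 : S ≠ 0 := hS0.ne'
      have e : k₁' * (t - k₁) / (S / h * ((h : ℝ) - S)) * (1 - S / h) = k₁' * (t - k₁) / S := by
        rw [show (1 : ℝ) - S / h = ((h : ℝ) - S) / h by field_simp]
        field_simp
      calc ρ * (1 - S / h) ≤ k₁' * (t - k₁) / (S / h * ((h : ℝ) - S)) * (1 - S / h) := mul_le_mul_of_nonneg_right hsum hw0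
        _ = _ := e
    -- the absorbed part x saves at least cap·(k₂ − S) ≥ m₂(k₂ − S) − (t − ℓ)m₁' of income
    have hsave₁ : cap * ((k₂ : ℝ) - S) ≤ x * (t - k₁) := by
      have hU := usage_mul_sub_le_light_or y t S j k₁ k₂ hy0 hy1 hk1low hk₂j hcomp₁ hyk₂ hSk₂ hSt hcase
      rw [← hU₁] at hU
      calc cap * ((k₂ : ℝ) - S) = x * (U₁ * ((k₂ : ℝ) - S)) := by rw [← hxU]; ring
        _ ≤ x * (t - k₁) := mul_le_mul_of_nonneg_left hU hx0
    have hsavel : m₂ * ((k₂ : ℝ) - S) - m₁' * (t - ((k₁ + a : ℕ) : ℝ)) ≤ cap * ((k₂ : ℝ) - S) := by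
      have hU := usage_mul_sub_le y t S j (k₁ + a) k₂ hy0 hy1 hllow hk₂j hcompl hyk₂ hSt htSl
      rw [← hUl] at hU
      have e : cap * ((k₂ : ℝ) - S) = m₂ * ((k₂ : ℝ) - S) - m₁' * (Ul * ((k₂ : ℝ) - S)) := by rw [hcap]; ring
      rw [e]; nlinarith [mul_le_mul_of_nonneg_left hU hm₁'0]
    -- incomes: m₁(t−k₁) + m₁'(t−ℓ) = (1−z)(1−λ)(S − k₁ − agz)
    have hinc : m₁ * (t - k₁) + m₁' * (t - ((k₁ + a : ℕ) : ℝ)) = (1 - z) * (1 - lam) * (S - k₁ - (a : ℝ) * g * z) := by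
      simp only [hm₁, hm₁']; push_cast; rw [ht]; ring
    have hl'inc : k₁' * (t - k₁) ≤ (1 - z) * (1 - lam) * (S - k₁ - (a : ℝ) * g * z) - m₂ * ((k₂ : ℝ) - S) := by
      rw [← hinc, hk₁']
      have : (m₁ - x) * (t - k₁) = m₁ * (t - k₁) - x * (t - k₁) := by ring
      linarith [hsave₁, hsavel, this]
    -- top-affordability closes it (verbatim as in regime C2)
    rw [div_mul_eq_mul_div, div_le_iff₀ h1y]
    have hS' : S - (1 - z) * ((k₁ : ℝ) + ((k₂ : ℝ) - k₁) * lam) = 0 := by rw [hmean]; ring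
    have key : y * (z * S + ((1 - z) * (1 - lam) * (S - k₁ - (a : ℝ) * g * z) - m₂ * ((k₂ : ℝ) - S))) ≤ m₂' * (1 - y) * S := by
      have e : z * S + ((1 - z) * (1 - lam) * (S - k₁ - (a : ℝ) * g * z) - m₂ * ((k₂ : ℝ) - S))
          = m₂' * ((k₂ : ℝ) - S) - (1 - z) * (1 - lam) * ((a : ℝ) * g * z)
            + (S - (1 - z) * ((k₁ : ℝ) + ((k₂ : ℝ) - k₁) * lam)) := by
        simp only [hm₂, hm₂']; ring
      rw [e, hS', add_zero]
      have t1 : 0 ≤ y * ((1 - z) * (1 - lam) * ((a : ℝ) * g * z)) := mul_nonneg hy0.le (mul_nonneg (mul_nonneg h1z.le h1lam) hagz)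
      have t2 : y * (m₂' * ((k₂ : ℝ) - S)) ≤ m₂' * (1 - y) * S := by
        have h3 : y * ((k₂ : ℝ) - S) ≤ (1 - y) * S := by linarith
        have h4 := mul_le_mul_of_nonneg_left h3 hm₂'0
        have e5 : y * (m₂' * ((k₂ : ℝ) - S)) = m₂' * (y * ((k₂ : ℝ) - S)) := by ring
        have e6 : m₂' * (1 - y) * S = m₂' * ((1 - y) * S) := by ring
        rw [e5, e6]; exact h4
      have e4 : y * (m₂' * ((k₂ : ℝ) - S) - (1 - z) * (1 - lam) * ((a : ℝ) * g * z))
          = y * (m₂' * ((k₂ : ℝ) - S)) - y * ((1 - z) * (1 - lam) * ((a : ℝ) * g * z)) := by ring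
      rw [e4]; linarith [t1, t2]
    calc y * (z + ρ * (1 - S / h)) ≤ y * (z + ((1 - z) * (1 - lam) * (S - k₁ - (a : ℝ) * g * z) - m₂ * ((k₂ : ℝ) - S)) / S) := by
          refine mul_le_mul_of_nonneg_left ?_ hy0.le
          have := div_le_div_of_nonneg_right hl'inc hS0.le
          linarith
      _ = y * (z * S + ((1 - z) * (1 - lam) * (S - k₁ - (a : ℝ) * g * z) - m₂ * ((k₂ : ℝ) - S))) / S := by
          field_simp
      _ ≤ m₂' * (1 - y) * S / S := div_le_div_of_nonneg_right key hS0.le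
      _ = m₂' * (1 - y) := by field_simp
  -- the P-side, part 2: the zeros ride the giant k₂ + a
  have Pg : FlowAtT y t j (M + a) (fun p => (θ * (1 - S / h) + (1 - θ) * z) * (if p = 0 then (1 : ℝ) else 0)
      + (1 - θ) * m₂' * (if p = k₂ + a then (1 : ℝ) else 0)) := by
    have hz' : 0 ≤ θ * (1 - S / h) + (1 - θ) * z := add_nonneg (mul_nonneg hθ0 hw0) (mul_nonneg h1θ.le hz0)
    refine flowAtT_of_giants y t j (M + a) _ hy0 hy1 (fun p => ?_) ?_
    · refine add_nonneg (mul_nonneg hz' ?_) (mul_nonneg (mul_nonneg h1θ.le hm₂'0) ?_) <;> split_ifs <;> norm_num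
    · have hl : ∑ l ∈ Finset.range (j + 1), (if 2 * (l : ℝ) < t then
          (θ * (1 - S / h) + (1 - θ) * z) * (if l = 0 then (1 : ℝ) else 0) + (1 - θ) * m₂' * (if l = k₂ + a then (1 : ℝ) else 0)
          else 0) = θ * (1 - S / h) + (1 - θ) * z := by
        have e : ∀ l ∈ Finset.range (j + 1), (if 2 * (l : ℝ) < t then
            (θ * (1 - S / h) + (1 - θ) * z) * (if l = 0 then (1 : ℝ) else 0) + (1 - θ) * m₂' * (if l = k₂ + a then (1 : ℝ) else 0)
            else 0) = (θ * (1 - S / h) + (1 - θ) * z) * (if l = 0 then (1 : ℝ) else 0) := by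
          intro l hl
          have hl' : l ≤ j := Nat.lt_succ_iff.1 (Finset.mem_range.1 hl)
          rw [if_neg (show l ≠ k₂ + a by omega)]
          by_cases hl0 : l = 0
          · subst hl0; rw [if_pos (by push_cast; linarith)]; ring
          · rw [if_neg hl0]; split_ifs <;> ring
        rw [Finset.sum_congr rfl e]
        exact sum_mul_indicator (fun _ => θ * (1 - S / h) + (1 - θ) * z) j 0 (by omega)
      have hg' : ∑ p ∈ Finset.Ico (j + 1) (M + a + 1),
          ((θ * (1 - S / h) + (1 - θ) * z) * (if p = 0 then (1 : ℝ) else 0) + (1 - θ) * m₂' * (if p = k₂ + a then (1 : ℝ) else 0))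
          = (1 - θ) * m₂' := by
        have e : ∀ p ∈ Finset.Ico (j + 1) (M + a + 1),
            ((θ * (1 - S / h) + (1 - θ) * z) * (if p = 0 then (1 : ℝ) else 0) + (1 - θ) * m₂' * (if p = k₂ + a then (1 : ℝ) else 0))
              = (1 - θ) * m₂' * (if p = k₂ + a then (1 : ℝ) else 0) := by
          intro p hp
          have : p ≠ 0 := by have := (Finset.mem_Ico.1 hp).1; omega
          rw [if_neg this]; ring
        rw [Finset.sum_congr rfl e, ← Finset.mul_sum, Finset.sum_ite_eq' (Finset.Ico (j + 1) (M + a + 1)) (k₂ + a),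
          if_pos (Finset.mem_Ico.2 ⟨hk₂aG, by omega⟩)]
        ring
      rw [hl, hg']
      have e1 : θ * (1 - S / h) + (1 - θ) * z = (1 - θ) * (z + ρ * (1 - S / h)) := by linear_combination (1 - S / h) * hθρ
      rw [e1, show y / (1 - y) * ((1 - θ) * (z + ρ * (1 - S / h))) = (1 - θ) * (y / (1 - y) * (z + ρ * (1 - S / h))) by ring]
      exact mul_le_mul_of_nonneg_left hineq h1θ.le
  -- assemble
  have hsumflow := FlowAtT.add W1 (FlowAtT.add (FlowAtT.add Pl P1) Pg)
  have hflow : FlowAtT y t j (M + a) (fun p => θ * weakMidLaw S g h a p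
      + (1 - θ) * (z * (if p = 0 then (1 : ℝ) else 0) + (1 - z) * slice (fun q => TP[k₁, k₂, lam, q]) a g p)) := by
    refine (congrArg (FlowAtT y t j (M + a)) (funext fun p => ?_)).mp hsumflow
    rw [movedTwoPoint_apply, ← hm₁, ← hm₁', ← hm₂, ← hm₂']
    unfold weakMidLaw
    have e1 : (1 - θ) * m₁ = c₁ * K₁ + (1 - θ) * x := by rw [hc₁K, hk₁']; ring
    have e2 : (1 - θ) * m₂ = (1 - θ) * (Ul * m₁') + (1 - θ) * cap := by rw [hcap]; ring
    have e3 : θ * (S / h * (1 - g)) = c₁ * (S / h * (1 - g)) := by rw [hcsum]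
    have e4 : θ * (S / h * g) = c₁ * (S / h * g) := by rw [hcsum]
    linear_combination (-(if p = k₁ then (1 : ℝ) else 0)) * e1 - (if p = k₂ then (1 : ℝ) else 0) * e2
      - (if p = h then (1 : ℝ) else 0) * e3 - (if p = h + a then (1 : ℝ) else 0) * e4
  exact gatedSliceMixLaw_conclusion_of_flowAtT y z g S lam θ a j M h k₁ k₂ hy0 hy1 hhM hk hk₂M hθ0 hθ1 hflow

end LawDec

end Quant

end Summit.CriticalPhenomena.PercolationContinuityZ3.Theorems
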